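import Mathlib
import HarnessLib
import Summits.HubbardSuperconductivity.HubbardSuperconductivity.Theorems.KLProgrammeC4aPPKernelTrueNumeratorD3

/-!
# Route `KLProgramme` — crux C4a, S3 brick (B4) «(B4)-UMK1», «(U1)-M-LAW» kernel side: the THIRD partner-level derivative `∂ᵤ³N` of the true numerator —
# part 2: the far bound `|∂ᵤ³N(e,u)| ≤ 9/|u|³` (`|u| > Λ`), the uniform bound `≤ (32B₃+96B₂+312B₁+180)/Λ³`, and the scale form

Cell `gate-hubbard-kl`, seat hubbard-kl-k3c3-p1 (g17; row «δμ-flow with klAngularMean constant piece»).  Continuation of `…C4aPPKernelTrueNumeratorD3` (kernel rows for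
k3c3-p3's «(U1)-M-LAW», pen (R384)(A)(a)): the sizes of `∂ᵤ³N = ppTrueNumeratorDuuu` that bound the second derivative of the signed kernel `N/(e+u)` near the
anti-diagonal (`|∂ᵤ²[N/(e+u)]| ≤ sup_segment |∂ᵤ³N|/3`).  No absolute value per frequency beyond the shell bookkeeping:
* §3 `ppTrueNumeratorDuuu_of_far` (`Λ < |u| ⟹ ∂ᵤ³N = (2/β)Σ W(ωₙ,e)L‴(ωₙ,u)`), **`abs_ppTrueNumeratorDuuu_far_le`** (`≤ 9/|u|³`: termwise `|L‴| ≤ 18/(ωₙ²+u²)²`,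
  `(2/β)Σ1/(ωₙ²+u²) = tanh(β|u|/2)/(2|u|)`);
* §4 **`abs_ppTrueNumeratorDuuu_le_unif`** (`≤ (32B₃+96B₂+312B₁+180)/Λ³` for all `e,u`; `|χ′| ≤ B₁`, `|χ″| ≤ B₂`, `|χ‴| ≤ B₃`);
* §5 **`abs_ppTrueNumeratorDuuu_le_of_scale`** (`M ≤ 2|v| ⟹ |∂ᵤ³N(e,v)| ≤ (256B₃+768B₂+2496B₁+1512)/M³`).
Pure real analysis; nothing asserts (C), K3, the window or superconductivity.
References: BGM 2006 §2.4 (2.36) [cite: BenfattoGiulianiMastropietro2006]; Salmhofer 1999 §4.2.5 (4.70)–(4.71) [cite: Salmhofer1999].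
-/

noncomputable section

namespace Summit.HubbardSuperconductivity.HubbardSuperconductivity.Theorems.C4a

set_option linter.dupNamespace false -- summit = problem name (single-conjunct summit), D-0017

open Real Filter Set
open scoped Topology
open Literature.MathematicalPhysics.QuantumLattice Literature.Analysis.SpecialFunctions

/-! ## §3 The far region -/

/-- **`Λ < |u| ⟹ ∂ᵤ³N(e,u) = (2/β)Σ W(ωₙ,e)·L‴(ωₙ,u)`** (the partner weight is `1`, its three derivatives vanish). [cite: BenfattoGiulianiMastropietro2006, §2.4 (2.36)] -/
theorem ppTrueNumeratorDuuu_of_far {β Λ u : ℝ} (hΛ : 0 < Λ) (hu : Λ < |u|) (e : ℝ) :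
    ppTrueNumeratorDuuu β Λ e u =
      2 / β * ∑' n : ℕ, uvWeightFn Λ (ppFreq β n) e * ((36 * ppFreq β n ^ 2 * u ^ 2 - 6 * u ^ 4 - 6 * ppFreq β n ^ 4) / (ppFreq β n ^ 2 + u ^ 2) ^ 4) := by
  unfold ppTrueNumeratorDuuu
  congr 1
  refine tsum_congr fun n => ?_
  have h : Λ ^ 2 < u ^ 2 + ppFreq β n ^ 2 := by
    have hu0 : 0 ≤ Λ := hΛ.le
    have : Λ ^ 2 < |u| ^ 2 := by nlinarith
    rw [sq_abs] at this
    nlinarith [sq_nonneg (ppFreq β n)]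
  obtain ⟨h0, h1, h2⟩ := uvWeightFn_eq_one_of_gt hΛ h
  rw [h0, h1, h2, uvWeightFnD3_eq_zero_of_gt hΛ h]; ring

/-- **`Λ < |u| ⟹ |∂ᵤ³N(e,u)| ≤ 9/|u|³`** (termwise `|L‴| ≤ 18/(ωₙ²+u²)² ≤ (18/u²)·1/(ωₙ²+u²)`, `(2/β)Σ1/(ωₙ²+u²) = tanh(β|u|/2)/(2|u|)`).
[cite: BenfattoGiulianiMastropietro2006, §2.4 (2.36)] -/
theorem abs_ppTrueNumeratorDuuu_far_le {β Λ u : ℝ} (hβ : 0 < β) (hΛ : 0 < Λ) (hu : Λ < |u|) (e : ℝ) : |ppTrueNumeratorDuuu β Λ e u| ≤ 9 / |u| ^ 3 := by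
  have hu0 : 0 < |u| := hΛ.trans hu
  have hune : u ≠ 0 := abs_pos.1 hu0
  have hω : ∀ n : ℕ, 0 < ppFreq β n := ppFreq_pos hβ
  rw [ppTrueNumeratorDuuu_of_far hΛ hu e, abs_mul, abs_of_pos (by positivity : (0 : ℝ) < 2 / β)]
  set g : ℕ → ℝ := fun n => 18 / u ^ 2 * (1 / (ppFreq β n ^ 2 + |u| ^ 2)) with hg
  have hbd : ∀ n : ℕ, ‖uvWeightFn Λ (ppFreq β n) e * ((36 * ppFreq β n ^ 2 * u ^ 2 - 6 * u ^ 4 - 6 * ppFreq β n ^ 4) / (ppFreq β n ^ 2 + u ^ 2) ^ 4)‖ ≤ g n :=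
    fun n => by
      have hq : 0 < ppFreq β n ^ 2 + u ^ 2 := by positivity
      rw [Real.norm_eq_abs, abs_mul]
      have h1 := abs_lorentzian_deriv3_le (ppFreq β n) u hq
      have h2 : 18 / (ppFreq β n ^ 2 + u ^ 2) ^ 2 ≤ g n := by
        have hg' : g n = 18 / (u ^ 2 * (ppFreq β n ^ 2 + u ^ 2)) := by simp only [hg]; rw [sq_abs]; field_simp
        rw [hg', div_le_div_iff₀ (pow_pos hq 2) (by positivity)]
        have hle : u ^ 2 ≤ ppFreq β n ^ 2 + u ^ 2 := by nlinarith [sq_nonneg (ppFreq β n)]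
        calc 18 * (u ^ 2 * (ppFreq β n ^ 2 + u ^ 2)) ≤ 18 * ((ppFreq β n ^ 2 + u ^ 2) * (ppFreq β n ^ 2 + u ^ 2)) := by gcongr
          _ = 18 * (ppFreq β n ^ 2 + u ^ 2) ^ 2 := by ring
      calc |uvWeightFn Λ (ppFreq β n) e| * |(36 * ppFreq β n ^ 2 * u ^ 2 - 6 * u ^ 4 - 6 * ppFreq β n ^ 4) / (ppFreq β n ^ 2 + u ^ 2) ^ 4|
          ≤ 1 * (18 / (ppFreq β n ^ 2 + u ^ 2) ^ 2) := mul_le_mul (abs_uvWeightFn_le_one _ _ _) h1 (abs_nonneg _) zero_le_one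
        _ ≤ g n := by rw [one_mul]; exact h2
  have hsg : Summable g := (summable_one_div_ppFreq_sq_add_sq hβ |u|).mul_left _
  have hgsum : ∑' n, g n = 18 / u ^ 2 * (β * Real.tanh (β * |u| / 2) / (4 * |u|)) := by
    simp only [hg]; rw [tsum_mul_left, tsum_one_div_ppFreq_sq_add_sq hβ hu0.ne']
  have ht := tsum_of_norm_bounded hsg.hasSum hbd
  rw [Real.norm_eq_abs, hgsum] at ht
  have htanh : Real.tanh (β * |u| / 2) ≤ 1 := (Real.tanh_lt_one _).le
  have hu2 : u ^ 2 = |u| ^ 2 := (sq_abs u).symm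
  calc 2 / β * |∑' n : ℕ, uvWeightFn Λ (ppFreq β n) e * ((36 * ppFreq β n ^ 2 * u ^ 2 - 6 * u ^ 4 - 6 * ppFreq β n ^ 4) / (ppFreq β n ^ 2 + u ^ 2) ^ 4)|
      ≤ 2 / β * (18 / u ^ 2 * (β * Real.tanh (β * |u| / 2) / (4 * |u|))) := mul_le_mul_of_nonneg_left ht (by positivity)
    _ = 9 / |u| ^ 3 * Real.tanh (β * |u| / 2) := by rw [hu2]; field_simp; ring
    _ ≤ 9 / |u| ^ 3 * 1 := mul_le_mul_of_nonneg_left htanh (by positivity)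
    _ = 9 / |u| ^ 3 := mul_one _

/-! ## §4 The uniform bound -/
set_option maxHeartbeats 400000 in
/-- **THE UNIFORM BOUND `|∂ᵤ³N(e,u)| ≤ (32B₃ + 96B₂ + 312B₁ + 180)/Λ³`** for all levels: per frequency the five shell terms are
`≤ (64B₃ + 192B₂ + 624B₁ + 360)/(Λ²(ωₙ²+Λ²))`, and `(2/β)Σ 1/(ωₙ²+Λ²) ≤ 1/(2Λ)`. [cite: BenfattoGiulianiMastropietro2006, §2.4 (2.36)] -/
theorem abs_ppTrueNumeratorDuuu_le_unif {β Λ : ℝ} (hβ : 0 < β) (hΛ : 0 < Λ) {B₁ B₂ B₃ : ℝ} (hB₁ : ∀ x, |deriv salmhoferCutoff x| ≤ B₁)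
    (hB₂ : ∀ x, |deriv (deriv salmhoferCutoff) x| ≤ B₂) (hB₃ : ∀ x, |deriv (deriv (deriv salmhoferCutoff)) x| ≤ B₃) (e u : ℝ) :
    |ppTrueNumeratorDuuu β Λ e u| ≤ (32 * B₃ + 96 * B₂ + 312 * B₁ + 180) / Λ ^ 3 := by
  have hB0 := salmhoferB₁_nonneg hB₁
  have hB20 : 0 ≤ B₂ := (abs_nonneg _).trans (hB₂ 0)
  have hB30 : 0 ≤ B₃ := (abs_nonneg _).trans (hB₃ 0)
  have hω : ∀ n : ℕ, 0 < ppFreq β n := ppFreq_pos hβ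
  unfold ppTrueNumeratorDuuu
  set C : ℝ := (64 * B₃ + 192 * B₂ + 624 * B₁ + 360) / Λ ^ 2 with hC
  set g : ℕ → ℝ := fun n => C * (1 / (ppFreq β n ^ 2 + Λ ^ 2)) with hg
  have hbd : ∀ n : ℕ, ‖uvWeightFn Λ (ppFreq β n) e *
      (uvWeightFnD3 Λ (ppFreq β n) u * (e / (ppFreq β n ^ 2 + e ^ 2) + u / (ppFreq β n ^ 2 + u ^ 2)) +
        3 * uvWeightFnD2 Λ (ppFreq β n) u * ((ppFreq β n ^ 2 - u ^ 2) / (ppFreq β n ^ 2 + u ^ 2) ^ 2) +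
        3 * uvWeightFnD1 Λ (ppFreq β n) u * (2 * u * (u ^ 2 - 3 * ppFreq β n ^ 2) / (ppFreq β n ^ 2 + u ^ 2) ^ 3) +
        uvWeightFn Λ (ppFreq β n) u * ((36 * ppFreq β n ^ 2 * u ^ 2 - 6 * u ^ 4 - 6 * ppFreq β n ^ 4) / (ppFreq β n ^ 2 + u ^ 2) ^ 4))‖ ≤ g n := fun n => by
    set ω := ppFreq β n with hωdef
    have hω0 : 0 < ω := hω n
    have hq : 0 < ω ^ 2 + u ^ 2 := by positivity
    have hZ : 0 < ω ^ 2 + Λ ^ 2 := by positivity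
    have hWe : |uvWeightFn Λ ω e| ≤ 1 := abs_uvWeightFn_le_one _ _ _
    have hWu : |uvWeightFn Λ ω u| ≤ 1 := abs_uvWeightFn_le_one _ _ _
    have hD3 := abs_uvWeightFnD3_le_shell hB₂ hB₃ hΛ ω u
    have hD2 := abs_uvWeightFnD2_le_shell hB₁ hB₂ hΛ ω u
    have hD1 := abs_uvWeightFnD1_le_shell hB₁ hΛ ω u
    -- (a) `|W_e·W‴(u)·L_e| ≤ |W‴|·2/Λ`
    have hWL : |uvWeightFn Λ ω e * (e / (ω ^ 2 + e ^ 2))| ≤ 2 / Λ := abs_uvWeightFn_mul_lorentzian_le hΛ ω e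
    have ha : |uvWeightFn Λ ω e * (uvWeightFnD3 Λ ω u * (e / (ω ^ 2 + e ^ 2)))| ≤ (8 * B₃ + 12 * B₂) / Λ ^ 3 * (2 * Λ ^ 2 / (ω ^ 2 + Λ ^ 2)) * (2 / Λ) := by
      rw [show uvWeightFn Λ ω e * (uvWeightFnD3 Λ ω u * (e / (ω ^ 2 + e ^ 2))) = uvWeightFnD3 Λ ω u * (uvWeightFn Λ ω e * (e / (ω ^ 2 + e ^ 2))) by ring,
        abs_mul]
      exact mul_le_mul hD3 hWL (abs_nonneg _) (by positivity)
    -- (b) `|W_e·W‴(u)·L_u| ≤ |W‴|·2/Λ` (on the shell `|L_u| ≤ 2/Λ`; below it `W‴ = 0`)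
    have hb : |uvWeightFn Λ ω e * (uvWeightFnD3 Λ ω u * (u / (ω ^ 2 + u ^ 2)))| ≤ (8 * B₃ + 12 * B₂) / Λ ^ 3 * (2 * Λ ^ 2 / (ω ^ 2 + Λ ^ 2)) * (2 / Λ) := by
      by_cases hlow : u ^ 2 + ω ^ 2 < Λ ^ 2 / 4
      · rw [uvWeightFnD3_eq_zero_of_lt hΛ hlow]; simp; positivity
      · have hs : Λ ^ 2 / 4 ≤ u ^ 2 + ω ^ 2 := not_lt.1 hlow
        have hLu := abs_lorentzian_le_of_shell hΛ hs
        rw [abs_mul, abs_mul]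
        calc |uvWeightFn Λ ω e| * (|uvWeightFnD3 Λ ω u| * |u / (ω ^ 2 + u ^ 2)|) ≤ 1 * ((8 * B₃ + 12 * B₂) / Λ ^ 3 * (2 * Λ ^ 2 / (ω ^ 2 + Λ ^ 2)) * (2 / Λ)) :=
              mul_le_mul hWe (mul_le_mul hD3 hLu (abs_nonneg _) (by positivity)) (by positivity) zero_le_one
          _ = _ := one_mul _
    -- (c) `|W_e·3W″(u)·L′(u)| ≤ 3|W″|·4/Λ²`
    have hc : |uvWeightFn Λ ω e * (3 * uvWeightFnD2 Λ ω u * ((ω ^ 2 - u ^ 2) / (ω ^ 2 + u ^ 2) ^ 2))| ≤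
        3 * ((4 * B₂ + 2 * B₁) / Λ ^ 2 * (2 * Λ ^ 2 / (ω ^ 2 + Λ ^ 2))) * (4 / Λ ^ 2) := by
      by_cases hlow : u ^ 2 + ω ^ 2 < Λ ^ 2 / 4
      · rw [(uvWeightFn_eq_zero_of_lt hΛ hlow).2.2]; simp; positivity
      · have hs : Λ ^ 2 / 4 ≤ ω ^ 2 + u ^ 2 := by linarith [not_lt.1 hlow]
        have hL1 : |(ω ^ 2 - u ^ 2) / (ω ^ 2 + u ^ 2) ^ 2| ≤ 4 / Λ ^ 2 :=
          (abs_lorentzian_deriv_le_inv hq).trans (by rw [div_le_div_iff₀ hq (by positivity)]; nlinarith)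
        rw [abs_mul, abs_mul, abs_mul, abs_of_pos (by norm_num : (0 : ℝ) < 3)]
        calc |uvWeightFn Λ ω e| * (3 * |uvWeightFnD2 Λ ω u| * |(ω ^ 2 - u ^ 2) / (ω ^ 2 + u ^ 2) ^ 2|) ≤
            1 * (3 * ((4 * B₂ + 2 * B₁) / Λ ^ 2 * (2 * Λ ^ 2 / (ω ^ 2 + Λ ^ 2))) * (4 / Λ ^ 2)) :=
              mul_le_mul hWe (mul_le_mul (mul_le_mul_of_nonneg_left hD2 (by norm_num)) hL1 (abs_nonneg _) (by positivity)) (by positivity) zero_le_one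
          _ = _ := one_mul _
    -- (d) `|W_e·3W′(u)·L″(u)| ≤ 3|W′|·48/Λ³` (on the shell `|L″| ≤ 6(|u|/(ω²+u²))(1/(ω²+u²)) ≤ 48/Λ³`)
    have hd : |uvWeightFn Λ ω e * (3 * uvWeightFnD1 Λ ω u * (2 * u * (u ^ 2 - 3 * ω ^ 2) / (ω ^ 2 + u ^ 2) ^ 3))| ≤
        3 * (2 * B₁ / Λ * (2 * Λ ^ 2 / (ω ^ 2 + Λ ^ 2))) * (48 / Λ ^ 3) := by
      by_cases hlow : u ^ 2 + ω ^ 2 < Λ ^ 2 / 4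
      · rw [(uvWeightFn_eq_zero_of_lt hΛ hlow).2.1]; simp; positivity
      · have hs : Λ ^ 2 / 4 ≤ u ^ 2 + ω ^ 2 := not_lt.1 hlow
        have hLu := abs_lorentzian_le_of_shell hΛ hs
        rw [abs_div, abs_of_pos hq] at hLu
        have h4 : 1 / (ω ^ 2 + u ^ 2) ≤ 4 / Λ ^ 2 := by rw [div_le_div_iff₀ hq (by positivity)]; nlinarith
        have hL2 : |2 * u * (u ^ 2 - 3 * ω ^ 2) / (ω ^ 2 + u ^ 2) ^ 3| ≤ 48 / Λ ^ 3 := by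
          refine (abs_lorentzian_deriv2_le ω u hq).trans ?_
          calc 6 * |u| / (ω ^ 2 + u ^ 2) ^ 2 = 6 * (|u| / (ω ^ 2 + u ^ 2)) * (1 / (ω ^ 2 + u ^ 2)) := by field_simp
            _ ≤ 6 * (2 / Λ) * (4 / Λ ^ 2) := by gcongr
            _ = 48 / Λ ^ 3 := by field_simp; ring
        rw [abs_mul, abs_mul, abs_mul, abs_of_pos (by norm_num : (0 : ℝ) < 3)]
        calc |uvWeightFn Λ ω e| * (3 * |uvWeightFnD1 Λ ω u| * |2 * u * (u ^ 2 - 3 * ω ^ 2) / (ω ^ 2 + u ^ 2) ^ 3|) ≤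
            1 * (3 * (2 * B₁ / Λ * (2 * Λ ^ 2 / (ω ^ 2 + Λ ^ 2))) * (48 / Λ ^ 3)) :=
              mul_le_mul hWe (mul_le_mul (mul_le_mul_of_nonneg_left hD1 (by norm_num)) hL2 (abs_nonneg _) (by positivity)) (by positivity) zero_le_one
          _ = _ := one_mul _
    -- (e) `|W_e·W(u)·L‴(u)| ≤ 360/(Λ²(ω²+Λ²))` (on the shell `1/(ω²+u²) ≤ 4/Λ²` and `≤ 5/(ω²+Λ²)`)
    have he' : |uvWeightFn Λ ω e * (uvWeightFn Λ ω u * ((36 * ω ^ 2 * u ^ 2 - 6 * u ^ 4 - 6 * ω ^ 4) / (ω ^ 2 + u ^ 2) ^ 4))| ≤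
        360 / Λ ^ 2 * (1 / (ω ^ 2 + Λ ^ 2)) := by
      by_cases hW : uvWeightFn Λ ω u = 0
      · rw [hW]; simp; positivity
      · have hs : Λ ^ 2 / 4 ≤ u ^ 2 + ω ^ 2 := sq_add_sq_ge_of_uvWeightFn_ne_zero hΛ hW
        have h4 : 1 / (ω ^ 2 + u ^ 2) ≤ 4 / Λ ^ 2 := by rw [div_le_div_iff₀ hq (by positivity)]; nlinarith
        have h5 : 1 / (ω ^ 2 + u ^ 2) ≤ 5 / (ω ^ 2 + Λ ^ 2) := by rw [div_le_div_iff₀ hq hZ]; nlinarith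
        have hL3 : |(36 * ω ^ 2 * u ^ 2 - 6 * u ^ 4 - 6 * ω ^ 4) / (ω ^ 2 + u ^ 2) ^ 4| ≤ 360 / Λ ^ 2 * (1 / (ω ^ 2 + Λ ^ 2)) := by
          refine (abs_lorentzian_deriv3_le ω u hq).trans ?_
          calc 18 / (ω ^ 2 + u ^ 2) ^ 2 = 18 * (1 / (ω ^ 2 + u ^ 2)) * (1 / (ω ^ 2 + u ^ 2)) := by field_simp
            _ ≤ 18 * (4 / Λ ^ 2) * (5 / (ω ^ 2 + Λ ^ 2)) := by gcongr
            _ = 360 / Λ ^ 2 * (1 / (ω ^ 2 + Λ ^ 2)) := by ring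
        rw [abs_mul, abs_mul]
        calc |uvWeightFn Λ ω e| * (|uvWeightFn Λ ω u| * |(36 * ω ^ 2 * u ^ 2 - 6 * u ^ 4 - 6 * ω ^ 4) / (ω ^ 2 + u ^ 2) ^ 4|) ≤
            1 * (1 * (360 / Λ ^ 2 * (1 / (ω ^ 2 + Λ ^ 2)))) :=
              mul_le_mul hWe (mul_le_mul hWu hL3 (abs_nonneg _) zero_le_one) (by positivity) zero_le_one
          _ = _ := by ring
    -- assemble
    have hsplit : uvWeightFn Λ ω e *
        (uvWeightFnD3 Λ ω u * (e / (ω ^ 2 + e ^ 2) + u / (ω ^ 2 + u ^ 2)) + 3 * uvWeightFnD2 Λ ω u * ((ω ^ 2 - u ^ 2) / (ω ^ 2 + u ^ 2) ^ 2) +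
          3 * uvWeightFnD1 Λ ω u * (2 * u * (u ^ 2 - 3 * ω ^ 2) / (ω ^ 2 + u ^ 2) ^ 3) +
          uvWeightFn Λ ω u * ((36 * ω ^ 2 * u ^ 2 - 6 * u ^ 4 - 6 * ω ^ 4) / (ω ^ 2 + u ^ 2) ^ 4)) =
        uvWeightFn Λ ω e * (uvWeightFnD3 Λ ω u * (e / (ω ^ 2 + e ^ 2))) + uvWeightFn Λ ω e * (uvWeightFnD3 Λ ω u * (u / (ω ^ 2 + u ^ 2))) +
          uvWeightFn Λ ω e * (3 * uvWeightFnD2 Λ ω u * ((ω ^ 2 - u ^ 2) / (ω ^ 2 + u ^ 2) ^ 2)) +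
          uvWeightFn Λ ω e * (3 * uvWeightFnD1 Λ ω u * (2 * u * (u ^ 2 - 3 * ω ^ 2) / (ω ^ 2 + u ^ 2) ^ 3)) +
          uvWeightFn Λ ω e * (uvWeightFn Λ ω u * ((36 * ω ^ 2 * u ^ 2 - 6 * u ^ 4 - 6 * ω ^ 4) / (ω ^ 2 + u ^ 2) ^ 4)) := by ring
    rw [Real.norm_eq_abs, hsplit]
    refine ((abs_add_le _ _).trans (add_le_add ((abs_add_le _ _).trans (add_le_add ((abs_add_le _ _).trans (add_le_add ((abs_add_le _ _).trans
      (add_le_add ha hb)) hc)) hd)) he')).trans (le_of_eq ?_)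
    simp only [hg, hC]
    field_simp
    ring
  have hsg : Summable g := (summable_one_div_ppFreq_sq_add_sq hβ Λ).mul_left C
  have hgsum : ∑' n, g n = C * (β * Real.tanh (β * Λ / 2) / (4 * Λ)) := by
    simp only [hg]; rw [tsum_mul_left, tsum_one_div_ppFreq_sq_add_sq hβ hΛ.ne']
  have ht := tsum_of_norm_bounded hsg.hasSum hbd
  rw [Real.norm_eq_abs, hgsum] at ht
  have htanh : Real.tanh (β * Λ / 2) ≤ 1 := (Real.tanh_lt_one _).le
  have hC0 : 0 ≤ C := by positivity
  rw [abs_mul, abs_of_pos (by positivity : (0 : ℝ) < 2 / β)]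
  calc 2 / β * |∑' n : ℕ, uvWeightFn Λ (ppFreq β n) e *
        (uvWeightFnD3 Λ (ppFreq β n) u * (e / (ppFreq β n ^ 2 + e ^ 2) + u / (ppFreq β n ^ 2 + u ^ 2)) +
          3 * uvWeightFnD2 Λ (ppFreq β n) u * ((ppFreq β n ^ 2 - u ^ 2) / (ppFreq β n ^ 2 + u ^ 2) ^ 2) +
          3 * uvWeightFnD1 Λ (ppFreq β n) u * (2 * u * (u ^ 2 - 3 * ppFreq β n ^ 2) / (ppFreq β n ^ 2 + u ^ 2) ^ 3) +
          uvWeightFn Λ (ppFreq β n) u * ((36 * ppFreq β n ^ 2 * u ^ 2 - 6 * u ^ 4 - 6 * ppFreq β n ^ 4) / (ppFreq β n ^ 2 + u ^ 2) ^ 4))|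
      ≤ 2 / β * (C * (β * Real.tanh (β * Λ / 2) / (4 * Λ))) := mul_le_mul_of_nonneg_left ht (by positivity)
    _ = C / (2 * Λ) * Real.tanh (β * Λ / 2) := by field_simp; ring
    _ ≤ C / (2 * Λ) * 1 := mul_le_mul_of_nonneg_left htanh (by positivity)
    _ = (32 * B₃ + 96 * B₂ + 312 * B₁ + 180) / Λ ^ 3 := by rw [hC]; field_simp; ring

/-! ## §5 Against a scale -/

/-- **`∂ᵤ³N` against a scale `M ≤ 2|v|`**: `|∂ᵤ³N(e,v)| ≤ (256B₃+768B₂+2496B₁+1512)/M³` (far levels `9/|v|³ ≤ 72/M³`; near levels `|v| ≤ Λ ⟹ M ≤ 2Λ` and the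
uniform bound). [cite: BenfattoGiulianiMastropietro2006, §2.4 (2.36)] -/
theorem abs_ppTrueNumeratorDuuu_le_of_scale {β Λ : ℝ} (hβ : 0 < β) (hΛ : 0 < Λ) {B₁ B₂ B₃ : ℝ} (hB₁ : ∀ x, |deriv salmhoferCutoff x| ≤ B₁)
    (hB₂ : ∀ x, |deriv (deriv salmhoferCutoff) x| ≤ B₂) (hB₃ : ∀ x, |deriv (deriv (deriv salmhoferCutoff)) x| ≤ B₃) {M v : ℝ} (hM : 0 < M)
    (hMv : M ≤ 2 * |v|) (e : ℝ) : |ppTrueNumeratorDuuu β Λ e v| ≤ (256 * B₃ + 768 * B₂ + 2496 * B₁ + 1512) / M ^ 3 := by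
  have hB0 := salmhoferB₁_nonneg hB₁
  have hB20 : 0 ≤ B₂ := (abs_nonneg _).trans (hB₂ 0)
  have hB30 : 0 ≤ B₃ := (abs_nonneg _).trans (hB₃ 0)
  rcases le_or_gt |v| Λ with hnear | hfar
  · have h := abs_ppTrueNumeratorDuuu_le_unif hβ hΛ hB₁ hB₂ hB₃ e v
    have hMΛ : M ≤ 2 * Λ := hMv.trans (by linarith)
    have hM3 : M ^ 3 ≤ 8 * Λ ^ 3 := by nlinarith [pow_le_pow_left₀ hM.le hMΛ 3]
    calc |ppTrueNumeratorDuuu β Λ e v| ≤ (32 * B₃ + 96 * B₂ + 312 * B₁ + 180) / Λ ^ 3 := h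
      _ ≤ (256 * B₃ + 768 * B₂ + 2496 * B₁ + 1440) / M ^ 3 := by rw [div_le_div_iff₀ (by positivity) (by positivity)]; nlinarith
      _ ≤ (256 * B₃ + 768 * B₂ + 2496 * B₁ + 1512) / M ^ 3 := div_le_div_of_nonneg_right (by linarith) (by positivity)
  · have h := abs_ppTrueNumeratorDuuu_far_le hβ hΛ hfar e
    have hv0 : 0 < |v| := hΛ.trans hfar
    have hv3 : M ^ 3 ≤ 8 * |v| ^ 3 := by nlinarith [pow_le_pow_left₀ hM.le hMv 3]
    calc |ppTrueNumeratorDuuu β Λ e v| ≤ 9 / |v| ^ 3 := h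
      _ ≤ 72 / M ^ 3 := by rw [div_le_div_iff₀ (by positivity) (by positivity)]; nlinarith
      _ ≤ (256 * B₃ + 768 * B₂ + 2496 * B₁ + 1512) / M ^ 3 := div_le_div_of_nonneg_right (by nlinarith) (by positivity)

end Summit.HubbardSuperconductivity.HubbardSuperconductivity.Theorems.C4a

end
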